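import Summits.BirchSwinnertonDyer.BirchSwinnertonDyer.Theorems.PrintCf2RubinValueTwoEllipticUnitsTwoVariableMeasure
import Literature.NumberTheory.EllipticCurves.ProfiniteGroupDistributionTwoVariableIntegral
import HarnessLib

/-!
# The INTEGRALS of de Shalit's two-variable measure on `Γ_K`, read at any modulus `𝔣_m` (II.4.14 (38), first line, with
# II.4.12 (29)↔(31) and II.4.7 (16)):
# `∫_{Γ_K} χ dμ = (χ(g_𝔠) − N𝔠)⁻¹ · Σ_{c ∈ Γ_K/Gal(K̄/K(𝔣_m))} χ(r_c) · ∫_{Gal(K̄/K(𝔣_m))} χ d i_𝔓((r_c⁻¹ • e_{𝔣_m}(𝔠))_𝔓)`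

Cell `bsd-print-cf2`, width seat `bsd-line-cf2-p1-w8` (g10 draft, g11 landing); `--supports` the banked S3a item
stmt-BirchSwinnertonDyer-24721 (helper, Theses-free).  THEOREMS ONLY; CONDITIONAL on the published named facts
`DeShalit1987.prop24_iii_unit`, `prop25_i_normRelation` (hypotheses, never asserted).

PRINT (de Shalit II.4.14, proof of (38), p. 71–72): the moments of the glued measure `μ_𝔞` on `𝒢 = Gal(K(𝔤p^∞)/K)` against a
character factoring through `Gal(K(𝔤𝔭̄^m𝔭^∞)/K)` are computed AT THE FIXED MODULUS `𝔣 = 𝔤𝔭̄^m` by II.4.12 (29)↔(31)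
(`μ_𝔠 = (σ_𝔠 − N𝔠)μ(𝔣)`) and II.4.7 (16): `∫_𝒢 χφ^k dμ⁰_β = Σ_𝔠 χφ^k(𝔠⁻¹) ∫_G φ^k dμ⁰_{σ_𝔠(β)}`.  For the measure `μ` of
`…EllipticUnitsTwoVariableMeasure.exists_twoVariable_groupDistribution_ellipticUnitsGlobal` (twisting relation at every level of the
diagonal tower, for a chain `𝔣_{m+1} = 𝔣_m𝔩`, `𝔩 ∣ 𝔣_m`, with coherent local models at `v`) THIS file proves:

* ★ `integral_twoVariable_eq_at` — **`∫_{Γ_K} χ dμ = (χ(g_𝔠) − N𝔠)⁻¹ · ∫_{Γ_K} χ d i_m(e_{𝔣_m}(𝔠))`** for every `𝔠`, every modulus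
  index `m` and every multiplicative `χ : Γ_K → ℂ₂` with `χ(1) = 1`, continuous for the `m`-th tower `Gal(K̄/K(𝔣_m v^{n+1}))` and with
  `χ(g_𝔠) ≠ N𝔠` (`GroupDistribution.integral_eq_of_glue_at`; the `μ_𝔠(𝔣_m) = i_m(e_{𝔣_m}(𝔠))` being compatible under coarsening by
  `pushforward_induceFrom_μ_ellipticUnitsGlobal_eq`, i.e. `N_{𝔣𝔩,𝔣} e_{𝔣𝔩}(𝔠) = e_𝔣(𝔠)`);
* ★★ `integral_twoVariable_eq_sum` — **`∫_{Γ_K} χ dμ = (χ(g_𝔠) − N𝔠)⁻¹ · Σ_{c ∈ Γ_K/Gal(K̄/K(𝔣_m))} χ(r_c) ∫_{Gal(K̄/K(𝔣_m))} χ d i_𝔓((r_c⁻¹ • e_{𝔣_m}(𝔠))_𝔓)`**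
  (`GroupDistribution.integral_eq_sum_of_glue_induceFrom_of_le`, `K(𝔣_m v) = K(𝔣_m)` at `𝒪_v ≅ ℤ₂`,
  `ker_le_absRayAdicTower_U_zero_of_padicIntEquiv_two`) — the socket into which the one-`𝔓` moments (`…EllipticUnitsLocalMoments`,
  B6) plug.

HONEST FRAMING: an assembly of accepted kernel theorems; nothing here closes a crux; no summit statement is proved; BSD is not proved
by any of this.

## References
* [deShalit1987] E. de Shalit, *Iwasawa theory of elliptic curves with complex multiplication* (1987), II.4.14 (38) (p. 71–72),
  II.4.7 (16) (p. 60), II.4.12 (29)–(31) (p. 66–69), II.4.17 (p. 77–78).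
-/

-- the summit namespace `Summit.BirchSwinnertonDyer.BirchSwinnertonDyer` repeats the problem name by design (D-0017)
set_option linter.dupNamespace false
set_option autoImplicit false

noncomputable section

open scoped Classical nonZeroDivisors
open scoped NumberField
open Field IsDedekindDomain IsDedekindDomain.HeightOneSpectrum ValuativeRel IsLocalRing MvPowerSeries
open Literature.NumberTheory.NumberFields
open Literature.NumberTheory.GaloisRepresentations Literature.NumberTheory.GaloisRepresentations.IsNonarchimedeanLocalField
  Literature.NumberTheory.GaloisRepresentations.LubinTate Literature.NumberTheory.GaloisRepresentations.ArtinLocalGlobal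
  Literature.NumberTheory.PAdicHodge
open Literature.NumberTheory.EllipticCurves Literature.NumberTheory.EllipticCurves.GroupDistribution
open Literature.NumberTheory.ComplexMultiplication.EllipticUnits
open Literature.NumberTheory.LFunctions.AbelianDensity (artinSymbol)
open Summit.BirchSwinnertonDyer.BirchSwinnertonDyer.Theorems.PrintCf2.EllipticUnitsLocal
open Summit.BirchSwinnertonDyer.BirchSwinnertonDyer.Theorems.PrintCf2.EllipticUnitsGlobal
open Summit.BirchSwinnertonDyer.BirchSwinnertonDyer.Theorems.PrintCf2.EllipticUnitsGlobalCompat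

namespace Summit.BirchSwinnertonDyer.BirchSwinnertonDyer.Theorems.PrintCf2.EllipticUnitsTwoVariable

variable {K : Type} [Field K] [NumberField K] {v 𝔩 : HeightOneSpectrum (𝓞 K)}

attribute [local instance] GlobalNormCoherentUnits.instCommMonoid GlobalNormCoherentUnits.galAction
attribute [local instance] ltNormUniformSpace ltNormIsUniformAddGroup rk1 nF nE fintypeResidueField
attribute [local instance] RelNormCoherentUnits.instCommMonoid

variable [NumberField.IsTotallyComplex K]
  -- the prints and the global frame
  (h24iii : DeShalit1987.prop24_iii_unit) (h25 : DeShalit1987.prop25_i_normRelation)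
  (hK : IsImaginaryQuadratic K) (ι : K →+* ℂ)
  -- the moduli `𝔣_{m+1} = 𝔣_m 𝔩`, `𝔩 ∣ 𝔣_m` (e.g. `𝔣_m = 𝔤𝔭̄^{m+1}`), all rigid and prime to `v`
  (𝔣 : ℕ → Ideal (𝓞 K)) (h𝔣succ : ∀ m, 𝔣 (m + 1) = 𝔣 m * 𝔩.asIdeal) (hle : ∀ m, 𝔣 (m + 1) ≤ 𝔣 m) (hdiv : ∀ m, 𝔩.asIdeal ∣ 𝔣 m)
  (h𝔣0 : ∀ m, 𝔣 m ≠ ⊥) (h𝔣1 : ∀ m, 𝔣 m ≠ ⊤) (hv : ∀ m, ¬ 𝔣 m ≤ v.asIdeal) (hw : ∀ (m : ℕ) (u : (𝓞 K)ˣ), (u : 𝓞 K) - 1 ∈ 𝔣 m → u = 1)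
  -- the common local datum at `v`: `π = u·2`, `σ₀`, `ε`, `θ`, `e₂`
  (hq : residueFieldCard (v.adicCompletion K) = 2)
  (h2 : (valuation (v.adicCompletion K)).IsUniformizer ((((2 : ℕ) : 𝒪[v.adicCompletion K]) : v.adicCompletion K)))
  (u : 𝒪[v.adicCompletion K]ˣ)
  {σ₀ : absoluteGaloisGroup (v.adicCompletion K)} (hσ₀ : IsAbsArithFrob σ₀)
  {ε : (maxUnramifiedCompletion (v.adicCompletion K))ˣ}
  (hε : maxUnramifiedCompletion.galAut (v.adicCompletion K) σ₀ (ε : maxUnramifiedCompletion (v.adicCompletion K)) =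
    algebraMap 𝒪[v.adicCompletion K] (maxUnramifiedCompletion (v.adicCompletion K)) (u : 𝒪[v.adicCompletion K]) *
      (ε : maxUnramifiedCompletion (v.adicCompletion K)))
  (θ : CompletedAlgClosure (v.adicCompletion K) →+* ℂ_[2])
  (hθ1 : ∀ z : CBall (v.adicCompletion K), ‖θ (z : CompletedAlgClosure (v.adicCompletion K))‖ ≤ 1)
  (e₂ : v.adicCompletionIntegers K ≃+* ℤ_[2])
  (hΘe : ∀ a : 𝒪[v.adicCompletion K], (θ.comp ((CBall (v.adicCompletion K)).subtype.comp
      (algebraMap (UnrCoeff (v.adicCompletion K)) (CBall (v.adicCompletion K))))) (intToUnrCoeff (v.adicCompletion K) a) =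
    padicIntCast ℂ_[2] (((e₂ : v.adicCompletionIntegers K →+* ℤ_[2]).comp
      (integerEquivAdicCompletionIntegers v).toRingHom) a))
  -- the per-modulus local models: global witnesses `α_m = π^{f_m}`, coefficient fields `E_m ≤ E_{m+1}`, readings `j_m`, cell maps `ψ_m`
  (α : ℕ → 𝓞 K) (hα0 : ∀ m, α m ≠ 0) (hα𝔣 : ∀ m, α m - 1 ∈ 𝔣 m) (hαw : ∀ m (w : HeightOneSpectrum (𝓞 K)), w ≠ v → α m ∉ w.asIdeal)
  (f : ℕ → ℕ) (hαπ : ∀ m, ((α m : K) : v.adicCompletion K) =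
    ((((u : 𝒪[v.adicCompletion K]) * ((2 : ℕ) : 𝒪[v.adicCompletion K]) : 𝒪[v.adicCompletion K]) : v.adicCompletion K)) ^ f m)
  (E : ℕ → IntermediateField (v.adicCompletion K) (AlgebraicClosure (v.adicCompletion K)))
  [hfd : ∀ m, FiniteDimensional (v.adicCompletion K) (E m)] [hgal : ∀ m, IsGalois (v.adicCompletion K) (E m)]
  (hE : ∀ m, E m ≤ maxUnramified (v.adicCompletion K))
  (hdegE : ∀ (m : ℕ) (w : WeilGroup (v.adicCompletion K)),
    WeilGroup.toAbsGalois (v.adicCompletion K) w ∈ (E m).fixingSubgroup → (f m : ℤ) ∣ WeilGroup.deg w)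
  (hEE : ∀ m, E m ≤ E (m + 1))
  (j : ∀ m : ℕ, unitBall (E m) →+* UnrCoeff (v.adicCompletion K))
  (hj : ∀ m, (j m).comp (algebraMap (LTCoeff (v.adicCompletion K)) (unitBall (E m))) =
    (intToUnrCoeff (v.adicCompletion K)).comp (LTCoeff.of (v.adicCompletion K)).symm.toRingHom)
  (hjC : ∀ m, (algebraMap (UnrCoeff (v.adicCompletion K)) (CBall (v.adicCompletion K))).comp (j m) = unitBallToCBall (E m))
  (hjj : ∀ (m : ℕ) (y : unitBall (E m)), j (m + 1) (inclUnitBall (F := v.adicCompletion K) (hEE m) y) = j m y)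
  (ψ : ∀ m n : ℕ, ↥(absRestrictNormalHom (rayClassField K (𝔣 m))).ker ⧸ (rayAdicTower (𝔪 := 𝔣 m) (h𝔣0 m) v).U n → ZMod (2 ^ (n + 1)))
  (hψ : ∀ (m n : ℕ) (g : ↥(absRestrictNormalHom (rayClassField K (𝔣 m))).ker), g ∈ (rayAdicTower (𝔪 := 𝔣 m) (h𝔣0 m) v).U 0 →
    ψ m n ((rayAdicTower (𝔪 := 𝔣 m) (h𝔣0 m) v).proj n g) =
      PadicInt.toZModPow (n + 1) ((((Units.map (e₂ : v.adicCompletionIntegers K →+* ℤ_[2]).toMonoidHom).comp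
        (rayAdicCharacter (h𝔣0 m) (hv m) (hw m)))⁻¹ g : ℤ_[2]ˣ) : ℤ_[2]))
  -- the twists: ideals `𝔠` prime to all `𝔣_m v`, ARBITRARY Galois lifts `g_𝔠 ∈ Γ_K`, elliptic-unit families at every modulus
  {I : Type*} (idl : I → Ideal (𝓞 K)) (hidl0 : ∀ i, idl i ≠ ⊥) (hidlc : ∀ i m, IsCoprime (idl i) (𝔣 m * v.asIdeal))
  (g : I → absoluteGaloisGroup K)
  (x : ∀ (i : I) (m k : ℕ), rayClassField K (𝔣 m * v.asIdeal ^ (k + 1)))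
  (hx : ∀ (i : I) (m k : ℕ), IsThetaValueOne ι (𝔣 m * v.asIdeal ^ (k + 1)) (idl i)
    (algClosureEmb ι ((x i m k : rayClassField K (𝔣 m * v.asIdeal ^ (k + 1))) : AlgebraicClosure K)))
  [hN : ∀ m n, ((rayAdicTower (𝔪 := 𝔣 m) (h𝔣0 m) v).U n).Normal]
  [hNabs : ∀ m n, ((absRayAdicTower (𝔪' := 𝔣 m) (h𝔣0 m) v).U n).Normal]

set_option maxHeartbeats 1600000 in
include h𝔣succ hdiv hj hΘe hjj in
/-- **The `μ_𝔠(𝔣_m) = i_m(e_{𝔣_m}(𝔠))` are compatible under coarsening, for EVERY `𝔠`** (`(id)_* i_{m+1}(e_{𝔣_{m+1}}(𝔠)) = i_m(e_{𝔣_m}(𝔠))`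
levelwise on `Γ_K`): `pushforward_induceFrom_μ_ellipticUnitsGlobal_eq` along the chain `𝔣_{m+1} = 𝔣_m𝔩` — the `hcompat` of
`GroupDistribution.integral_eq_of_glue_at`.  GIVEN II.2.4 (iii), II.2.5 (i).
[cite: deShalit1987, II.4.14 Step 1 (p. 71), II.4.12 (ii) (p. 67), III.1.2 Lemma (ii) (p. 89), II.2.5 (i) (p. 47)] -/
theorem pushforward_induceFrom_μ_ellipticUnitsGlobal_eq_chain (c : I) (m n : ℕ)
    (a : absoluteGaloisGroup K ⧸ (absRayAdicTower (𝔪' := 𝔣 m) (h𝔣0 m) v).U n) :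
    ((GroupDistribution.induceFrom (Γ := absoluteGaloisGroup K) (fun k ↦ rayAdicTower_U_eq_subgroupOf (𝔪 := 𝔣 (m + 1)) (h𝔣0 (m + 1)) v k)
        (fun b : GlobalNormCoherentUnits (h𝔣0 (m + 1)) v ↦
          localMeasureFamily (h𝔣0 (m + 1)) (hv (m + 1)) (hw (m + 1)) hq h2 u (E (m + 1)) (hE (m + 1)) hσ₀ hε θ hθ1 (j (m + 1))
            (hjC (m + 1)) e₂ (ψ (m + 1)) (hψ (m + 1))
            (RelNormCoherentUnits.ofGlobalUnits (h𝔣0 (m + 1)) (hv (m + 1)) (hw (m + 1)) (isUniformizer_unit_mul h2 u) (hα0 (m + 1))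
              (hα𝔣 (m + 1)) (hαw (m + 1)) (hαπ (m + 1)) (E (m + 1)) (hE (m + 1)) (hdegE (m + 1)) b))
        zero_le_one (fun _ ↦ le_rfl)
        (ellipticUnitsGlobal h24iii h25 hK ι (h𝔣0 (m + 1)) (h𝔣1 (m + 1)) (hv (m + 1)) (hw (m + 1)) (hidl0 c) (hidlc c (m + 1))
          (x c (m + 1)) (hx c (m + 1)))).pushforward (MonoidHom.id (absoluteGaloisGroup K))
        (SubgroupTower.le_comap_id (fun m ↦ absRayAdicTower (𝔪' := 𝔣 m) (h𝔣0 m) v)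
          (fun m n ↦ absRayAdicTower_U_anti (h𝔣0 m) (h𝔣0 (m + 1)) v (hle m) n) m)).μ n a =
      (GroupDistribution.induceFrom (Γ := absoluteGaloisGroup K) (fun k ↦ rayAdicTower_U_eq_subgroupOf (𝔪 := 𝔣 m) (h𝔣0 m) v k)
        (fun b : GlobalNormCoherentUnits (h𝔣0 m) v ↦
          localMeasureFamily (h𝔣0 m) (hv m) (hw m) hq h2 u (E m) (hE m) hσ₀ hε θ hθ1 (j m) (hjC m) e₂ (ψ m) (hψ m)
            (RelNormCoherentUnits.ofGlobalUnits (h𝔣0 m) (hv m) (hw m) (isUniformizer_unit_mul h2 u) (hα0 m) (hα𝔣 m) (hαw m)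
              (hαπ m) (E m) (hE m) (hdegE m) b))
        zero_le_one (fun _ ↦ le_rfl)
        (ellipticUnitsGlobal h24iii h25 hK ι (h𝔣0 m) (h𝔣1 m) (hv m) (hw m) (hidl0 c) (hidlc c m) (x c m) (hx c m))).μ n a := by
  haveI : FiniteDimensional (v.adicCompletion K) (E (m + 1)) := hfd (m + 1)
  haveI : IsGalois (v.adicCompletion K) (E (m + 1)) := hgal (m + 1)
  have hjj' : (j (m + 1)).comp (inclUnitBall (F := v.adicCompletion K) (hEE m) : unitBall (E m) →+* unitBall (E (m + 1))) = j m :=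
    RingHom.ext (hjj m)
  exact pushforward_induceFrom_μ_ellipticUnitsGlobal_eq hq h2 u hσ₀ hε θ hθ1 e₂ hΘe (h𝔣0 m) (h𝔣1 m) (hv m) (hw m) (hα0 m) (hα𝔣 m)
    (hαw m) (hαπ m) (E m) (hE m) (hdegE m) (j m) (hj m) (hjC m) (ψ m) (hψ m) (h𝔣0 (m + 1)) (h𝔣1 (m + 1)) (hv (m + 1)) (hw (m + 1))
    (hα0 (m + 1)) (hα𝔣 (m + 1)) (hαw (m + 1)) (hαπ (m + 1)) (E (m + 1)) (hE (m + 1)) (hdegE (m + 1)) (j (m + 1)) (hj (m + 1))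
    (hjC (m + 1)) (ψ (m + 1)) (hψ (m + 1)) (h𝔣succ m) (hle m) (hdiv m) (hEE m) hjj' h24iii h25 hK ι (hidl0 c) (hidlc c m)
    (hidlc c (m + 1)) (x c m) (hx c m) (x c (m + 1)) (hx c (m + 1)) n a

set_option maxHeartbeats 1600000 in
include h𝔣succ hdiv hj hΘe hjj in
/-- ★ **THE INTEGRALS OF THE TWO-VARIABLE MEASURE, READ AT THE MODULUS `𝔣_m`** (de Shalit II.4.14 (38), first line, with II.4.12
(29)↔(31)): for a bounded distribution `μ` on `Γ_K` along the diagonal tower `V_n = Gal(K̄/K(𝔣_n v^{n+1}))` with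
`δ_{g_𝔠, N𝔠} μ = i_n(e_{𝔣_n}(𝔠))` at every level `n` (as produced by `exists_twoVariable_groupDistribution_ellipticUnitsGlobal`), every
modulus index `m` and every multiplicative `χ : Γ_K → ℂ₂` with `χ(1) = 1`, continuous for the `m`-th tower `Gal(K̄/K(𝔣_m v^{n+1}))` and with
`χ(g_𝔠) ≠ N𝔠`: **`∫_{Γ_K} χ dμ = (χ(g_𝔠) − N𝔠)⁻¹ · ∫_{Γ_K} χ d i_m(e_{𝔣_m}(𝔠))`**, `i_m = induceFrom` of the one-`𝔓` family at the modulus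
`𝔣_m` — the glued `μ_𝔠` integrates `𝒰^{(m)}`-continuous functions like `μ_𝔠(𝔣_m)` (`GroupDistribution.integral_eq_of_glue_at`, the
compatibility being `pushforward_induceFrom_μ_ellipticUnitsGlobal_eq_chain`).  GIVEN II.2.4 (iii), II.2.5 (i).
[cite: deShalit1987, II.4.14 (38) (p. 71–72), II.4.12 (29)↔(31) (p. 67–69)] -/
theorem integral_twoVariable_eq_at
    (μ : GroupDistribution (SubgroupTower.diagonal (fun m ↦ absRayAdicTower (𝔪' := 𝔣 m) (h𝔣0 m) v)
        (fun m n ↦ absRayAdicTower_U_anti (h𝔣0 m) (h𝔣0 (m + 1)) v (hle m) n)) ℂ_[2]) (c : I)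
    (hμ : ∀ (n : ℕ) (b : absoluteGaloisGroup K ⧸ (absRayAdicTower (𝔪' := 𝔣 n) (h𝔣0 n) v).U n),
        (twisting (g c) (Ideal.absNorm (idl c) : ℂ_[2]) μ).μ n b =
        (GroupDistribution.induceFrom (Γ := absoluteGaloisGroup K) (fun k ↦ rayAdicTower_U_eq_subgroupOf (𝔪 := 𝔣 n) (h𝔣0 n) v k)
          (fun b : GlobalNormCoherentUnits (h𝔣0 n) v ↦
            localMeasureFamily (h𝔣0 n) (hv n) (hw n) hq h2 u (E n) (hE n) hσ₀ hε θ hθ1 (j n) (hjC n) e₂ (ψ n) (hψ n)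
              (RelNormCoherentUnits.ofGlobalUnits (h𝔣0 n) (hv n) (hw n) (isUniformizer_unit_mul h2 u) (hα0 n) (hα𝔣 n) (hαw n)
                (hαπ n) (E n) (hE n) (hdegE n) b))
          zero_le_one (fun _ ↦ le_rfl)
          (ellipticUnitsGlobal h24iii h25 hK ι (h𝔣0 n) (h𝔣1 n) (hv n) (hw n) (hidl0 c) (hidlc c n) (x c n) (hx c n))).μ n b)
    (m : ℕ) {χ : absoluteGaloisGroup K → ℂ_[2]} (hχc : (absRayAdicTower (𝔪' := 𝔣 m) (h𝔣0 m) v).IsTowerContinuous χ)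
    (hχ : ∀ y z, χ (y * z) = χ y * χ z) (h1 : χ 1 = 1) (hne : χ (g c) ≠ (Ideal.absNorm (idl c) : ℂ_[2])) :
    μ.integral χ = (χ (g c) - (Ideal.absNorm (idl c) : ℂ_[2]))⁻¹ *
      (GroupDistribution.induceFrom (Γ := absoluteGaloisGroup K) (fun k ↦ rayAdicTower_U_eq_subgroupOf (𝔪 := 𝔣 m) (h𝔣0 m) v k)
          (fun b : GlobalNormCoherentUnits (h𝔣0 m) v ↦
            localMeasureFamily (h𝔣0 m) (hv m) (hw m) hq h2 u (E m) (hE m) hσ₀ hε θ hθ1 (j m) (hjC m) e₂ (ψ m) (hψ m)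
              (RelNormCoherentUnits.ofGlobalUnits (h𝔣0 m) (hv m) (hw m) (isUniformizer_unit_mul h2 u) (hα0 m) (hα𝔣 m) (hαw m)
                (hαπ m) (E m) (hE m) (hdegE m) b))
          zero_le_one (fun _ ↦ le_rfl)
          (ellipticUnitsGlobal h24iii h25 hK ι (h𝔣0 m) (h𝔣1 m) (hv m) (hw m) (hidl0 c) (hidlc c m) (x c m) (hx c m))).integral χ :=
  integral_eq_of_glue_at (p := 2) (G := absoluteGaloisGroup K) (𝒰 := fun m ↦ absRayAdicTower (𝔪' := 𝔣 m) (h𝔣0 m) v)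
    (href := fun m n ↦ absRayAdicTower_U_anti (h𝔣0 m) (h𝔣0 (m + 1)) v (hle m) n) (B := fun m ↦ GlobalNormCoherentUnits (h𝔣0 m) v)
    (fun m (b : GlobalNormCoherentUnits (h𝔣0 m) v) ↦ GroupDistribution.induceFrom (Γ := absoluteGaloisGroup K)
      (fun k ↦ rayAdicTower_U_eq_subgroupOf (𝔪 := 𝔣 m) (h𝔣0 m) v k)
      (fun b : GlobalNormCoherentUnits (h𝔣0 m) v ↦
        localMeasureFamily (h𝔣0 m) (hv m) (hw m) hq h2 u (E m) (hE m) hσ₀ hε θ hθ1 (j m) (hjC m) e₂ (ψ m) (hψ m)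
          (RelNormCoherentUnits.ofGlobalUnits (h𝔣0 m) (hv m) (hw m) (isUniformizer_unit_mul h2 u) (hα0 m) (hα𝔣 m) (hαw m)
            (hαπ m) (E m) (hE m) (hdegE m) b))
      zero_le_one (fun _ ↦ le_rfl) b)
    (fun m c ↦ ellipticUnitsGlobal h24iii h25 hK ι (h𝔣0 m) (h𝔣1 m) (hv m) (hw m) (hidl0 c) (hidlc c m) (x c m) (hx c m)) g
    (fun c ↦ Ideal.absNorm (idl c)) μ c hμ zero_le_one (fun _ ↦ le_rfl)
    (pushforward_induceFrom_μ_ellipticUnitsGlobal_eq_chain h24iii h25 hK ι 𝔣 h𝔣succ hle hdiv h𝔣0 h𝔣1 hv hw hq h2 u hσ₀ hε θ hθ1 e₂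
      hΘe α hα0 hα𝔣 hαw f hαπ E hE hdegE hEE j hj hjC hjj ψ hψ idl hidl0 hidlc x hx c)
    m hχc hχ h1 hne

set_option maxHeartbeats 1600000 in
include h𝔣succ hdiv hj hΘe hjj in
/-- ★★ **THE INTEGRALS OF THE TWO-VARIABLE MEASURE AT THE MODULUS `𝔣_m`, DECOMPOSED OVER `Γ_K ⧸ Gal(K̄/K(𝔣_m))`** (de Shalit II.4.14
(38), first line, with II.4.12 (29)↔(31) and II.4.7 (16)): in the setting of `integral_twoVariable_eq_at`,
**`∫_{Γ_K} χ dμ = (χ(g_𝔠) − N𝔠)⁻¹ · Σ_{c ∈ Γ_K/Gal(K̄/K(𝔣_m v))} χ(r_c) · ∫_{Gal(K̄/K(𝔣_m))} χ d i_𝔓((r_c⁻¹ • e_{𝔣_m}(𝔠))_𝔓)`** — the induced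
measure's integral decomposes over the cosets (`GroupDistribution.integral_eq_sum_of_glue_induceFrom_of_le`; `K(𝔣_m v) = K(𝔣_m)` at
`𝒪_v ≅ ℤ₂`, `ker_le_absRayAdicTower_U_zero_of_padicIntEquiv_two`, so no indicator), each term an integral against the one-`𝔓` measure of
the Galois CONJUGATE `r_c⁻¹ • e_{𝔣_m}(𝔠)` of the elliptic units (de Shalit's `Σ_𝔠 χ(𝔠⁻¹) ∫_G … dμ_{σ_𝔠(β)}`) — the inputs of
`…EllipticUnitsLocalMoments`.  GIVEN II.2.4 (iii), II.2.5 (i).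
[cite: deShalit1987, II.4.14 (38) (p. 71–72), II.4.7 (16) (p. 60), II.4.12 (29)↔(31) (p. 67–69), II.4.17 (p. 77–78)] -/
theorem integral_twoVariable_eq_sum
    (μ : GroupDistribution (SubgroupTower.diagonal (fun m ↦ absRayAdicTower (𝔪' := 𝔣 m) (h𝔣0 m) v)
        (fun m n ↦ absRayAdicTower_U_anti (h𝔣0 m) (h𝔣0 (m + 1)) v (hle m) n)) ℂ_[2]) (c : I)
    (hμ : ∀ (n : ℕ) (b : absoluteGaloisGroup K ⧸ (absRayAdicTower (𝔪' := 𝔣 n) (h𝔣0 n) v).U n),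
        (twisting (g c) (Ideal.absNorm (idl c) : ℂ_[2]) μ).μ n b =
        (GroupDistribution.induceFrom (Γ := absoluteGaloisGroup K) (fun k ↦ rayAdicTower_U_eq_subgroupOf (𝔪 := 𝔣 n) (h𝔣0 n) v k)
          (fun b : GlobalNormCoherentUnits (h𝔣0 n) v ↦
            localMeasureFamily (h𝔣0 n) (hv n) (hw n) hq h2 u (E n) (hE n) hσ₀ hε θ hθ1 (j n) (hjC n) e₂ (ψ n) (hψ n)
              (RelNormCoherentUnits.ofGlobalUnits (h𝔣0 n) (hv n) (hw n) (isUniformizer_unit_mul h2 u) (hα0 n) (hα𝔣 n) (hαw n)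
                (hαπ n) (E n) (hE n) (hdegE n) b))
          zero_le_one (fun _ ↦ le_rfl)
          (ellipticUnitsGlobal h24iii h25 hK ι (h𝔣0 n) (h𝔣1 n) (hv n) (hw n) (hidl0 c) (hidlc c n) (x c n) (hx c n))).μ n b)
    (m : ℕ) {χ : absoluteGaloisGroup K → ℂ_[2]} (hχc : (absRayAdicTower (𝔪' := 𝔣 m) (h𝔣0 m) v).IsTowerContinuous χ)
    (hχ : ∀ y z, χ (y * z) = χ y * χ z) (h1 : χ 1 = 1) (hne : χ (g c) ≠ (Ideal.absNorm (idl c) : ℂ_[2])) :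
    μ.integral χ = (χ (g c) - (Ideal.absNorm (idl c) : ℂ_[2]))⁻¹ *
      ∑ c' ∈ (absRayAdicTower (𝔪' := 𝔣 m) (h𝔣0 m) v).cells 0, χ ((absRayAdicTower (𝔪' := 𝔣 m) (h𝔣0 m) v).repr 0 c') *
        (localMeasureFamily (h𝔣0 m) (hv m) (hw m) hq h2 u (E m) (hE m) hσ₀ hε θ hθ1 (j m) (hjC m) e₂ (ψ m) (hψ m)
          (RelNormCoherentUnits.ofGlobalUnits (h𝔣0 m) (hv m) (hw m) (isUniformizer_unit_mul h2 u) (hα0 m) (hα𝔣 m) (hαw m) (hαπ m)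
            (E m) (hE m) (hdegE m)
            (((absRayAdicTower (𝔪' := 𝔣 m) (h𝔣0 m) v).repr 0 c')⁻¹ •
              ellipticUnitsGlobal h24iii h25 hK ι (h𝔣0 m) (h𝔣1 m) (hv m) (hw m) (hidl0 c) (hidlc c m) (x c m) (hx c m)))).integral
          (fun y : ↥(absRestrictNormalHom (rayClassField K (𝔣 m))).ker ↦ χ y) :=
  integral_eq_sum_of_glue_induceFrom_of_le (p := 2) (G := absoluteGaloisGroup K)
    (𝒰 := fun m ↦ absRayAdicTower (𝔪' := 𝔣 m) (h𝔣0 m) v)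
    (href := fun m n ↦ absRayAdicTower_U_anti (h𝔣0 m) (h𝔣0 (m + 1)) v (hle m) n) (B := fun m ↦ GlobalNormCoherentUnits (h𝔣0 m) v)
    (H := fun m ↦ (absRestrictNormalHom (rayClassField K (𝔣 m))).ker) (𝒱 := fun m ↦ rayAdicTower (𝔪 := 𝔣 m) (h𝔣0 m) v)
    (fun m k ↦ rayAdicTower_U_eq_subgroupOf (𝔪 := 𝔣 m) (h𝔣0 m) v k)
    (fun m (b : GlobalNormCoherentUnits (h𝔣0 m) v) ↦
      localMeasureFamily (h𝔣0 m) (hv m) (hw m) hq h2 u (E m) (hE m) hσ₀ hε θ hθ1 (j m) (hjC m) e₂ (ψ m) (hψ m)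
        (RelNormCoherentUnits.ofGlobalUnits (h𝔣0 m) (hv m) (hw m) (isUniformizer_unit_mul h2 u) (hα0 m) (hα𝔣 m) (hαw m)
          (hαπ m) (E m) (hE m) (hdegE m) b))
    zero_le_one (fun _ _ ↦ le_rfl)
    (fun m c ↦ ellipticUnitsGlobal h24iii h25 hK ι (h𝔣0 m) (h𝔣1 m) (hv m) (hw m) (hidl0 c) (hidlc c m) (x c m) (hx c m)) g
    (fun c ↦ Ideal.absNorm (idl c)) μ c hμ
    (pushforward_induceFrom_μ_ellipticUnitsGlobal_eq_chain h24iii h25 hK ι 𝔣 h𝔣succ hle hdiv h𝔣0 h𝔣1 hv hw hq h2 u hσ₀ hε θ hθ1 e₂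
      hΘe α hα0 hα𝔣 hαw f hαπ E hE hdegE hEE j hj hjC hjj ψ hψ idl hidl0 hidlc x hx c)
    m (ker_le_absRayAdicTower_U_zero_of_padicIntEquiv_two (h𝔣0 m) (hv m) (hw m) e₂) hχc hχ h1 hne

end Summit.BirchSwinnertonDyer.BirchSwinnertonDyer.Theorems.PrintCf2.EllipticUnitsTwoVariable

end
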